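import Mathlib
import Summits.KontsevichZagierPeriods.Zeta5Search.BrickStripDerivLocal
import Summits.KontsevichZagierPeriods.Zeta5Search.BrickBallApery

/-!
# BrickLucas — THE LUCAS CONGRUENCE for the leading coefficients of the very-well-poised brick linear forms:
`x_{A−1}(n₀ + Np) ≡ x_{A−1}(n₀)·x_{A−1}(N) (mod p)` at every odd prime, hence
`x_{A−1}(n) ≡ ∏_i x_{A−1}(n_i) (mod p)` over the base-`p` digits of `n` (cell zeta5-irr)

HONEST FRAMING: systematic search; no irrationality claim unless certified. INSTRUMENT-tier arithmetic of the ζ(5)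
census cell zeta5-irr (HOME `run/shared/lean/pub/zeta5-irr/`), filed by the engine seat zi-eng (g13); numeric lead
`zi-eng/lean-g12/FINDINGS-g12.md` §4. WHAT THIS IS NOT: nothing about ζ(5) ∈ ℝ∖ℚ; no denominator saving; 0 nats/n;
rung F-Z1 NOT moved. For `(A,B) = (4,1)` (Ball's kernel, `x_3 = bₙ` the Apéry numbers) this is Gessel's 1982
Theorem 1, already in the tree by Gessel's digit-by-digit binomial argument
(`Literature.Combinatorics.Enumerative.AperyLucasCongruences.aperyNumber_modEq_mul`) — re-derived here as a
CALIBRATION; for `(6,1)` it is a Lucas congruence for Zudilin's `uₙ = 1, 9, 469, 38601, 4008501, …` (the `ζ(5)`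
coefficient of his 2002 well-poised forms, `BrickLinearForms.uC_eq_xCoeff`), and for the cell's `ζ(5)`-type kernels
`(6,2), (8,B)` likewise — the cell's literature desk found no printed statement for these (`uₙ` is not a sum of products of
binomials to which Gessel's argument applies; zi-lit R5.5 / this seat g12).

## The route (the files `BrickLucasAssembly` … `BrickStripDerivLocal` of this seat)

`p·c_{k,A−1}(n) = λ_k c̃_{K,A−1}(N) + w₁(k) c̃_{K,A}(N)` cell by cell (the depth-one two-scale identity, `w₁` the strip
derivative); the multipliers of one digit are the Taylor data of one rational function (`BrickBlockShift.lambda_shift`: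
`λ_{k'} ≡ λ_k − (K'−K)w₁(k) (mod p^{2e+2})`); the strip derivative is cross-row local (`BrickStripDerivLocal.stripDeriv_local`:
`w₁(k₀ + Kp; n₀ + Np) ≡ p·c_{k₀,A−1}(n₀) (mod p²)`, through the depth-one cell as a harmonic logarithmic derivative, the
digit shift `p·H_{x₀+Xp} ≡ H_X + p·H_{x₀} (mod p²)`, and Gauss–Wilson blocks for the carry digits); so the block weight
of the constant weight is `W(K) ≡ p·x_{A−1}(n₀)·(N/2 − K)` to all digit orders, its defect is `p²×`(an admissible weight),
and zi-p2's PROPOSITION H^∞ closes the induction over the levels (`BrickLucasAssembly.lucas_of_blockLaws`).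

## Statements (`p` an ODD prime, `A` even, `1 ≤ B`, `2B ≤ A`; `x = xLead A B = x_{A−1}` of the kernel `(A,B,1)`)

* **`lucas`**: `v(x(n₀ + Np) − x(n₀)·x(N)) ≤ exp(−1)` for every `n₀ < p` and every `N`.
* **`lucas_mod_div`**: `v(x(n) − x(n mod p)·x(n / p)) ≤ exp(−1)` for every `n`.
* `xLead_zero`: `x(0) = 1`; `padicValuation_xLead_le_one`: `x(n) ∈ ℤ_(p)`;
  **`lucas_digits`**: `v(x(n) − ∏_{d ∈ digits_p(n)} x(d)) ≤ exp(−1)`.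
* **`uC_lucas`** (`(A,B) = (6,1)`, Zudilin's `uₙ`): `v(u_{n₀+Np} − u_{n₀}·u_N) ≤ exp(−1)`.
* **`aperyNumber_lucas'`** (`(A,B) = (4,1)`): `b_{Kp + m} ≡ b_m·b_K (mod p)` in `ℤ` — Gessel's Theorem 1 at odd `p`,
  re-derived through the brick chain (calibration).
-/

namespace Summit.KontsevichZagierPeriods.Zeta5Search.BrickLucas

open Finset Nat WithZero
open Summit.KontsevichZagierPeriods.Zeta5Search.BrickTopCoefficient (cTop)
open Summit.KontsevichZagierPeriods.Zeta5Search.BrickLaurent (laurent laurent_zero)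
open Summit.KontsevichZagierPeriods.Zeta5Search.BrickLaurentValuation (laurent_succ_succ)
open Summit.KontsevichZagierPeriods.Zeta5Search.BrickPartialFractions (xCoeff)
open Summit.KontsevichZagierPeriods.Zeta5Search.BrickDenominators (padicValuation_xCoeff_le)
open Summit.KontsevichZagierPeriods.Zeta5Search.BrickLinearForms (uC_eq_xCoeff)
open Summit.KontsevichZagierPeriods.Zeta5Search.BrickBallApery (xCoeff_three_eq_aperyNumber
  padicValuation_intCast_le_exp_neg_iff)
open Summit.KontsevichZagierPeriods.Zeta5Search.BrickLucasAssembly (xLead xCoeff_pred_eq lucas_of_blockLaws)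
open Summit.KontsevichZagierPeriods.Zeta5Search.BrickStripDerivLocal (law_V law_W cTop_zero_zero)
open Literature.NumberTheory.Irrationality.Zudilin2002 (uC)
open Literature.Combinatorics.Enumerative.AperyNumbers (aperyNumber)

noncomputable section

variable {p : ℕ} [Fact p.Prime]

section lucas

variable (hp2 : p ≠ 2) {A B : ℕ} (hA : Even A) (hB : 1 ≤ B) (hAB : 2 * B ≤ A)
include hp2 hA hB hAB

/-- **THE LUCAS CONGRUENCE** for the leading coefficient `x = x_{A−1}` of the very-well-poised brick kernel `(A,B,1)`
at every odd prime `p` (`A` even, `1 ≤ B ≤ A/2`): for every `n₀ < p` and every `N`,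
`v(x(n₀ + Np) − x(n₀)·x(N)) ≤ exp(−1)`, i.e. `x(n₀ + Np) ≡ x(n₀)·x(N) (mod p)`. -/
theorem lucas {n₀ : ℕ} (hn₀ : n₀ < p) (N : ℕ) :
    Rat.padicValuation p (xLead A B (n₀ + N * p) - xLead A B n₀ * xLead A B N) ≤ exp (-1 : ℤ) := by
  have hp : p.Prime := Fact.out
  have hN : N < p ^ (N + 1) :=
    calc N < 2 ^ N := Nat.lt_two_pow_self
      _ ≤ p ^ N := Nat.pow_le_pow_left hp.two_le N
      _ ≤ p ^ (N + 1) := Nat.pow_le_pow_right hp.pos (by omega)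
  exact lucas_of_blockLaws hp2 hA hB hAB hn₀ hN (fun K hK => law_V hp2 hAB hB hn₀ hK)
    (fun K K' e hK hK' hdvd => law_W hp2 hAB hB hn₀ hK hK' hdvd)

/-- **Lucas, `mod`/`div` form**: `v(x(n) − x(n mod p)·x(n / p)) ≤ exp(−1)` for every `n`. -/
theorem lucas_mod_div (n : ℕ) :
    Rat.padicValuation p (xLead A B n - xLead A B (n % p) * xLead A B (n / p)) ≤ exp (-1 : ℤ) := by
  have hp : p.Prime := Fact.out
  have h := lucas hp2 hA hB hAB (Nat.mod_lt n hp.pos) (n / p)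
  rwa [Nat.mod_add_div' n p] at h

omit hp2 hA in
/-- `x_{A−1}(0) = 1` (the kernel of the empty row is `t^{1−A}`). -/
theorem xLead_zero : xLead A B 0 = 1 := by
  rw [xLead, xCoeff_pred_eq (by omega : 1 ≤ A), Finset.sum_range_one, show (1 : ℕ) = 0 + 1 from rfl,
    laurent_succ_succ A B 0 0 0 0, laurent_zero hAB 0 le_rfl, cTop_zero_zero]
  simp

/-- `x_{A−1}(n) ∈ ℤ_(p)` (the leading coefficient needs no `d_n`; `BrickDenominators`). -/
theorem padicValuation_xLead_le_one (n : ℕ) : Rat.padicValuation p (xLead A B n) ≤ 1 := by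
  have h := padicValuation_xCoeff_le hp2 hA hB hAB n (A - 1)
  rwa [show (A - 1 - (A - 1) : ℕ) = 0 from Nat.sub_self _, Nat.cast_zero, mul_zero, exp_zero] at h

/-- **LUCAS OVER ALL DIGITS**: `v(x(n) − ∏_{d ∈ digits_p n} x(d)) ≤ exp(−1)`, i.e.
`x_{A−1}(n₀ + n₁p + ⋯ + n_s p^s) ≡ x_{A−1}(n₀)·x_{A−1}(n₁)⋯x_{A−1}(n_s) (mod p)`. -/
theorem lucas_digits (n : ℕ) :
    Rat.padicValuation p (xLead A B n - ((Nat.digits p n).map (xLead A B)).prod) ≤ exp (-1 : ℤ) := by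
  have hp : p.Prime := Fact.out
  induction n using Nat.strong_induction_on with
  | _ n ih =>
    rcases Nat.eq_zero_or_pos n with rfl | hn
    · rw [Nat.digits_zero, List.map_nil, List.prod_nil, xLead_zero hB hAB, sub_self, map_zero]; exact _root_.zero_le
    rw [Nat.digits_def' hp.one_lt hn, List.map_cons, List.prod_cons]
    have h1 := lucas_mod_div hp2 hA hB hAB n
    have h2 := ih (n / p) (Nat.div_lt_self hn hp.one_lt)
    rw [show xLead A B n - xLead A B (n % p) * ((Nat.digits p (n / p)).map (xLead A B)).prod =
      (xLead A B n - xLead A B (n % p) * xLead A B (n / p)) +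
        xLead A B (n % p) * (xLead A B (n / p) - ((Nat.digits p (n / p)).map (xLead A B)).prod) by ring]
    refine (Valuation.map_add _ _ _).trans (max_le h1 ?_)
    rw [map_mul]
    calc _ ≤ 1 * exp (-1 : ℤ) := mul_le_mul' (padicValuation_xLead_le_one hp2 hA hB hAB _) h2
      _ = _ := one_mul _

end lucas

/-! ## Printed objects: Zudilin's `uₙ` and the Apéry numbers -/

/-- **LUCAS CONGRUENCE FOR ZUDILIN'S `uₙ`** (`rₙ = uₙζ(5) + wₙζ(3) − vₙ`, Math. Notes 72 (2002); `uₙ = x_5(n)` of the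
kernel `(6,1,1)`): for every odd prime `p`, `n₀ < p`, every `N`: `v(u_{n₀ + Np} − u_{n₀}·u_N) ≤ exp(−1)`. -/
theorem uC_lucas (hp2 : p ≠ 2) {n₀ : ℕ} (hn₀ : n₀ < p) (N : ℕ) :
    Rat.padicValuation p (uC (n₀ + N * p) - uC n₀ * uC N) ≤ exp (-1 : ℤ) := by
  have h := lucas (A := 6) (B := 1) hp2 ⟨3, rfl⟩ le_rfl (by norm_num) hn₀ N
  simpa only [xLead, uC_eq_xCoeff] using h

/-- **Zudilin's `uₙ` over all digits**: `v(uₙ − ∏_{d ∈ digits_p n} u_d) ≤ exp(−1)` at every odd prime. -/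
theorem uC_lucas_digits (hp2 : p ≠ 2) (n : ℕ) :
    Rat.padicValuation p (uC n - ((Nat.digits p n).map uC).prod) ≤ exp (-1 : ℤ) := by
  have h := lucas_digits (A := 6) (B := 1) hp2 ⟨3, rfl⟩ le_rfl (by norm_num) n
  have e : xLead 6 1 = uC := by funext m; rw [xLead, uC_eq_xCoeff]
  rwa [e] at h

/-- **GESSEL'S THEOREM 1 RE-DERIVED through the brick chain** (calibration; `(A,B) = (4,1)`, `x_3 = bₙ` the Apéry
numbers): for every ODD prime `p`, every `K` and `m < p`, `b_{Kp + m} ≡ b_m·b_K (mod p)`. The Literature's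
`AperyLucasCongruences.aperyNumber_modEq_mul` is the same congruence for every prime by Gessel's own argument. -/
theorem aperyNumber_lucas' (hp2 : p ≠ 2) (K : ℕ) {m : ℕ} (hm : m < p) :
    ((aperyNumber (K * p + m) : ℕ) : ℤ) ≡ (aperyNumber m : ℕ) * (aperyNumber K : ℕ) [ZMOD (p : ℤ)] := by
  have h := lucas (A := 4) (B := 1) hp2 ⟨2, rfl⟩ le_rfl (by norm_num) hm K
  simp only [xLead, show (4 - 1 : ℕ) = 3 from rfl, xCoeff_three_eq_aperyNumber, show m + K * p = K * p + m by ring] at h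
  rw [← Int.cast_natCast, ← Int.cast_natCast (aperyNumber m), ← Int.cast_natCast (aperyNumber K), ← Int.cast_mul,
    ← Int.cast_sub, show (-1 : ℤ) = -((1 : ℕ) : ℤ) by norm_num, padicValuation_intCast_le_exp_neg_iff, pow_one] at h
  exact (Int.modEq_iff_dvd.2 h).symm

end

end Summit.KontsevichZagierPeriods.Zeta5Search.BrickLucas
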